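import Summits.BirchSwinnertonDyer.BirchSwinnertonDyer.Theorems.GenusKolyvaginAtTwoGenusPrimitiveSupplyAtTwoPrimeTwistInertRat
import HarnessLib

/-!
# Route `GenusKolyvaginAtTwo`, crux #2 `GenusPrimitiveSupplyAtTwo` (stmt-BirchSwinnertonDyer-22136):
# THE PRIME-TWIST SELMER SANDWICH `Sel₂^{str ∞}(W) ≤ Sel_𝔓(A_χ/ℚ) ≤ Sel₂^{rel ∞}(W)` for descent-admissible `d`, and `Sel_𝔓(A_χ) = Sel₂(W)` when `Δ_W < 0`

Width seat `bsd-line-gk2-p5` g14 (cell `bsd-f1-sign2`, SUPPLY lineage of crux 22136), file 34 of the series; sequel of file 33 (`…PrimeTwistInertRat`,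
DESC-§17-R unconditional). THEOREMS ONLY (no definition, no named fact, no `sorry`); helper `--supports stmt-BirchSwinnertonDyer-22136`; no item is
closed; BSD is not proved by any of this.

WHAT (Mazur–Rubin 2010 Lemma 3.2 with `T = {∞}` in prime-twist currency, `p = 2`, `K = ℚ`). For a globally minimal elliptic `W/ℚ`, a descent-admissible
`d` (`d < 0`, `d ≡ 1 (8)`, primes of `d` good with `a_p` odd, `(d/ℓ) = 1` at the odd bad `ℓ`) and its quadratic character `χ`:
* §140 **`primeTwist_selmerLocalKer_adicCompletion_eq_of_descAdmissible`** — THE ONE-PLACE DICTIONARY AT EVERY FINITE PLACE, as an EQUALITY: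
  `H¹_𝒜(ℚ_v, E[2]) = H¹_f(ℚ_v, E[2])` for every finite `v` (split places: file 30 §124; primes of `d`: `W(ℚ_v)[2] = 0`; inert good places: file 32).
* §141 **`selmerGroup_kummerStrict_le_primeTwist_selmerGroup`** / **`primeTwist_selmerGroup_le_selmerGroupRelaxedAtInfinityAtTwo`** — THE SANDWICH
  `Sel₂^{str ∞}(W) ≤ Sel_𝔓(A_χ/ℚ) ≤ Sel₂^{rel ∞}(W)` inside `H¹(ℚ, E[2])` (the two ends differ by `#𝓛_∞ ∈ {1, 2}`: files 16/17 of this lineage).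
* §142 **`primeTwist_selmerGroup_eq_selmerGroup_of_Δ_neg`** — for `Δ_W < 0` the sandwich collapses: `Sel_𝔓(A_χ/ℚ) = Sel₂(W) = Sel₂^{rel ∞}(W) =
  Sel₂^{str ∞}(W)` (`E(ℝ) ≅ S¹` is `2`-divisible, `#𝓛_∞ = 1`).
* §143 `primeTwist_selmerGroup_le_selmerGroup_of_meetsEgg` — for `Δ_W > 0` on the egg stratum `Sel_𝔓(A_χ/ℚ) ≤ Sel₂(W)` (`Sel₂^{rel ∞} = Sel₂` there), and
  `Sel₂^{str ∞}(W) = ker(loc_∞ | Sel₂(W))` sits below with index `≤ 2`.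

Honest framing: KNOWN in print (MR 2010 §3, MR 2007 §§4–5, Kramer 1981); kernel-new bookkeeping; beyond-print theorem: no. Crux 22136 stays OPEN exactly at
(U) 24947 ∧ (CONV₂) 19220/24948. BSD is not proved by any of this.

References: [MazurRubin2010] Def. 3.1, Lemma 3.2, Lemma 2.10; [MazurRubin2007] Def 4.3, Cor 4.6, §5; [Kramer1981] Prop. 6, Prop. 7.
-/

set_option linter.dupNamespace false -- tree convention: `Summit.BirchSwinnertonDyer.BirchSwinnertonDyer.Theorems` (summit = sub-problem)
set_option autoImplicit false

noncomputable section

open scoped Classical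

namespace Summit.BirchSwinnertonDyer.BirchSwinnertonDyer.Theorems.GenusKolyArch

open WeierstrassCurve Field NumberField IsDedekindDomain Function
open Literature.NumberTheory.EllipticCurves Literature.NumberTheory.GaloisRepresentations
open Literature.NumberTheory.GaloisCohomology
open Summit.BirchSwinnertonDyer.BirchSwinnertonDyer.Theorems.GenusKolyTwistLocal
open Summit.BirchSwinnertonDyer.Rank1Residual.X11b.KummerPT (kummerStrict kummerRelaxed)
open Summit.BirchSwinnertonDyer.Rank1Residual.F1Sign2
open Rat.HeightOneSpectrum (primesEquiv natGenerator)

variable (W : WeierstrassCurve ℚ) [W.IsElliptic] [W.IsGloballyMinimal] {d : ℤ} {χ : absoluteGaloisGroup ℚ →ₜ* Multiplicative (ZMod 2)}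

/-! ## §140 The one-place dictionary at every finite place -/

/-- **Over a prime of a descent-admissible `d`, `W(ℚ_v)[2] = 0`** (the prime is odd, good, with `a_p` odd — `GenusKolyTwin.silent_iff_odd_frobeniusTrace`),
and the place is odd. [cite: Kramer1981, Prop. 3] -/
theorem natCard_ker_nsmul_eq_one_of_descAdmissible_of_dvd (hd : DescAdmissible W d) (v : HeightOneSpectrum (𝓞 ℚ))
    (hpd : ((primesEquiv v : ℕ) : ℤ) ∣ d) :
    ((2 : ℕ) : 𝓞 ℚ) ∉ v.asIdeal ∧
      Nat.card (nsmulAddMonoidHom 2 : (W.baseChange (v.adicCompletion ℚ)).toAffine.Point →+ _).ker = 1 := by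
  obtain ⟨-, -, hd8, hprimes, -⟩ := hd
  haveI := Fact.mk (primesEquiv v).2
  have hpP : (primesEquiv v : ℕ).Prime := (primesEquiv v).2
  have hpv : ((primesEquiv v : ℕ) : 𝓞 ℚ) ∈ v.asIdeal := Rat.HeightOneSpectrum.natCast_natGenerator_mem v
  have hp2 : (primesEquiv v : ℕ) ≠ 2 := by
    intro h
    rw [h] at hpd
    omega
  have h2v : ((2 : ℕ) : 𝓞 ℚ) ∉ v.asIdeal :=
    GenusKolyTwistingPrime.natCast_not_mem_of_not_dvd hpP hpv fun h ↦
      hp2 ((Nat.prime_dvd_prime_iff_eq hpP Nat.prime_two).mp h)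
  obtain ⟨hgoodp, hodd⟩ := hprimes _ hpP hpd
  have hgood' : W.HasGoodReductionAtPrime (primesEquiv v : ℕ) := hgoodp inferInstance
  have hpΔ : ¬ ((primesEquiv v : ℕ) : ℤ) ∣ minimalDiscriminantInt W :=
    W.not_dvd_minimalDiscriminantInt_of_hasGoodReductionAtPrime' _ hgood'
  have hsil := (GenusKolyTwin.silent_iff_odd_frobeniusTrace W hp2 hpΔ).mpr hodd
  refine ⟨h2v, ?_⟩
  rw [natCard_ker_nsmul_adicCompletion_eq_padic W v 2]
  have h0 := GenusKolyTwin.twoTorsion_padic_eq_zero_of_forall_ne W hp2 hpΔ hsil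
  rw [Nat.card_eq_one_iff_unique]
  exact ⟨⟨fun a b ↦ Subtype.ext ((h0 a.1 a.2).trans (h0 b.1 b.2).symm)⟩, ⟨⟨0, by simp⟩⟩⟩

/-- **THE ONE-PLACE DICTIONARY AT EVERY FINITE PLACE (descent-admissible `d`): `H¹_𝒜(ℚ_v, E[2]) = H¹_f(ℚ_v, E[2])`** — the `𝔓`-Selmer local
condition of the prime twist `A_χ` and `W`'s own Kummer condition coincide at every finite place: at a place with a local `√d` (so `v = 2`, the odd bad
primes, the split good primes) by file 30 §124; over a prime of `d` because `W(ℚ_v)[2] = 0` kills `H¹(ℚ_v, E[2])`'s relevant part (§124); at an inert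
good prime by file 32 (`ℚ_v(√d)` unramified: Mazur's norm theorem and `H¹(K'/ℚ_v, E(K')) = 0`).
[cite: MazurRubin2010, Lemma 2.10] [cite: MazurRubin2007, Def 4.3 and Cor 4.6] [cite: Kramer1981, Prop. 3 and Prop. 7] -/
theorem primeTwist_selmerLocalKer_adicCompletion_eq_of_descAdmissible (hd : DescAdmissible W d) (hχ : IsQuadraticCharacterOf χ d)
    (v : HeightOneSpectrum (𝓞 ℚ)) :
    PrimeTwist.selmerLocalKer W χ (v.adicCompletion ℚ) = W.selmerLocalKer (v.adicCompletion ℚ) 2 := by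
  by_cases hpd : ((primesEquiv v : ℕ) : ℤ) ∣ d
  · obtain ⟨h2v, hker⟩ := natCard_ker_nsmul_eq_one_of_descAdmissible_of_dvd W hd v hpd
    exact primeTwist_selmerLocalKer_adicCompletion_eq_of_natCard_ker_eq_one W χ v h2v hker
  rcases descAdmissible_place_trichotomy W hd v with hsq | ⟨h2v, hker⟩ | ⟨h2v, hgood, hns⟩
  · exact primeTwist_selmerLocalKer_adicCompletion_eq_of_exists_sq W hχ v hsq
  · exact primeTwist_selmerLocalKer_adicCompletion_eq_of_natCard_ker_eq_one W χ v h2v hker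
  · exact primeTwist_selmerLocalKer_eq_of_inert W v χ hgood (closureEmb_geomSqrt_mem_maxUnramified_of_not_dvd v h2v hpd) hns
      (localChar_eq_one_iff_of_isQuadraticCharacterOf hχ)

/-! ## §141 The sandwich `Sel₂^{str ∞}(W) ≤ Sel_𝔓(A_χ/ℚ) ≤ Sel₂^{rel ∞}(W)` -/

/-- **Lower slice: `Sel₂^{str ∞}(W) ≤ Sel_𝔓(A_χ/ℚ)`** — a class in `W`'s Kummer condition at every finite place and TRIVIAL at `∞` lies in the `𝔓`-Selmer
group of the prime twist (finite places: §140; at `∞` a locally trivial class satisfies every restriction-kernel condition).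
[cite: MazurRubin2010, Def. 3.1 and Lemma 3.2] [cite: MazurRubin2007, Def 4.3] -/
theorem selmerGroup_kummerStrict_le_primeTwist_selmerGroup (hd : DescAdmissible W d) (hχ : IsQuadraticCharacterOf χ d) (w : InfinitePlace ℚ) :
    (kummerStrict W 2 {(Sum.inl w : Place ℚ)}).selmerGroup ≤ PrimeTwist.selmerGroup W χ := by
  intro c hc
  obtain ⟨hR, hloc⟩ := (mem_selmerGroup_kummerStrict_singleton_inl_iff W w c).mp hc
  refine (PrimeTwist.mem_selmerGroup_iff W χ c).mpr ⟨fun v ↦ ?_, fun w' ↦ ?_⟩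
  · exact (primeTwist_selmerLocalKer_adicCompletion_eq_of_descAdmissible W hd hχ v).ge
      ((mem_selmerGroupRelaxedAtInfinityAtTwo_iff W c).mp hR v)
  · obtain rfl : w' = w := Subsingleton.elim _ _
    exact PrimeTwist.mem_selmerLocalKer_of_res_eq_zero W χ w'.Completion hloc

/-- **Upper slice: `Sel_𝔓(A_χ/ℚ) ≤ Sel₂^{rel ∞}(W)`** — DESC-§17-R part 1, now unconditional (file 33). [cite: MazurRubin2010, Def. 3.1 and Lemma 3.2] -/
theorem primeTwist_selmerGroup_le_selmerGroupRelaxedAtInfinityAtTwo (hd : DescAdmissible W d) (hχ : IsQuadraticCharacterOf χ d) :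
    PrimeTwist.selmerGroup W χ ≤ selmerGroupRelaxedAtInfinityAtTwo W :=
  (twistSelmerEqRelaxedAtInfinityAtTwo_holds W d χ hd hχ).1

omit [W.IsGloballyMinimal] in
/-- **The strict end has index `#𝓛_∞ ≤ 2` in the relaxed end** (`= 2` for `Δ_W > 0`, `= 1` for `Δ_W < 0`; files 16–17), so `Sel_𝔓(A_χ/ℚ)` is pinned
to one of at most three subgroups. [cite: MazurRubin2010, Lemma 3.2] [cite: Kramer1981, Prop. 6] -/
theorem relIndex_kummerStrict_selmerGroupRelaxedAtInfinityAtTwo_le_two (w : InfinitePlace ℚ) :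
    (kummerStrict W 2 {(Sum.inl w : Place ℚ)}).selmerGroup.relIndex (selmerGroupRelaxedAtInfinityAtTwo W) ≤ 2 := by
  rcases lt_trichotomy W.Δ 0 with hΔ | hΔ | hΔ
  · rw [relIndex_kummerStrict_selmerGroupRelaxedAtInfinityAtTwo_eq_one_of_Δ_neg W hΔ w]; norm_num
  · exact absurd hΔ W.isUnit_Δ.ne_zero
  · rw [relIndex_kummerStrict_selmerGroupRelaxedAtInfinityAtTwo_eq_two_of_Δ_pos W hΔ w]

/-! ## §142 `Δ_W < 0`: the sandwich collapses -/

omit [W.IsGloballyMinimal] in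
/-- For `Δ_W < 0`, `Sel₂^{str ∞}(W) = Sel₂^{rel ∞}(W)` (`#𝓛_∞ = 1`). [cite: Kramer1981, Prop. 6] [cite: MazurRubin2010, Lemma 3.2] -/
theorem selmerGroup_kummerStrict_eq_selmerGroupRelaxedAtInfinityAtTwo_of_Δ_neg (hΔ : W.Δ < 0) (w : InfinitePlace ℚ) :
    (kummerStrict W 2 {(Sum.inl w : Place ℚ)}).selmerGroup = selmerGroupRelaxedAtInfinityAtTwo W := by
  have h1 := relIndex_kummerStrict_selmerGroupRelaxedAtInfinityAtTwo_eq_one_of_Δ_neg W hΔ w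
  rw [AddSubgroup.relIndex_eq_one] at h1
  exact le_antisymm ((selmerGroup_kummerStrict_singleton_inl_le_selmerGroup W w).trans
    (selmerGroup_le_selmerGroupRelaxedAtInfinityAtTwo W)) h1

/-- **`Δ_W < 0`: `Sel_𝔓(A_χ/ℚ) = Sel₂^{rel ∞}(W)`** for every descent-admissible `d` — NO cardinality hypothesis (DESC-§17-R's equality clause is
automatic off the egg sign). [cite: MazurRubin2010, Lemma 3.2] [cite: Kramer1981, Prop. 6] -/
theorem primeTwist_selmerGroup_eq_selmerGroupRelaxedAtInfinityAtTwo_of_Δ_neg (hΔ : W.Δ < 0) (hd : DescAdmissible W d)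
    (hχ : IsQuadraticCharacterOf χ d) : PrimeTwist.selmerGroup W χ = selmerGroupRelaxedAtInfinityAtTwo W := by
  let w : InfinitePlace ℚ := Rat.infinitePlace
  refine le_antisymm (primeTwist_selmerGroup_le_selmerGroupRelaxedAtInfinityAtTwo W hd hχ) ?_
  rw [← selmerGroup_kummerStrict_eq_selmerGroupRelaxedAtInfinityAtTwo_of_Δ_neg W hΔ w]
  exact selmerGroup_kummerStrict_le_primeTwist_selmerGroup W hd hχ w

/-- **`Δ_W < 0`: `Sel_𝔓(A_χ/ℚ) = Sel₂(W/ℚ)` inside `H¹(ℚ, E[2])`** for every descent-admissible `d` and its character — the prime-twist Selmer group IS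
the curve's `2`-Selmer group (all local conditions agree: finite places §140, the real place is invisible for `Δ < 0`).
[cite: MazurRubin2010, Lemma 3.2 and Prop. 3.3] [cite: MazurRubin2007, Cor 4.6] [cite: Kramer1981, Prop. 6 and Thm. 1] -/
theorem primeTwist_selmerGroup_eq_selmerGroup_of_Δ_neg (hΔ : W.Δ < 0) (hd : DescAdmissible W d) (hχ : IsQuadraticCharacterOf χ d) :
    PrimeTwist.selmerGroup W χ = W.selmerGroup ((2 : ℕ) : ℤ) := by
  rw [primeTwist_selmerGroup_eq_selmerGroupRelaxedAtInfinityAtTwo_of_Δ_neg W hΔ hd hχ]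
  exact selmerGroupRelaxedAtInfinityAtTwo_eq_selmerGroup_of_Δ_neg W hΔ

/-- `Δ_W < 0`: `#Sel_𝔓(A_χ/ℚ) = #Sel₂(W)`. [cite: Kramer1981, Thm. 1] [cite: MazurRubin2010, Prop. 3.3] -/
theorem natCard_primeTwist_selmerGroup_eq_selmerTwoCard_of_Δ_neg (hΔ : W.Δ < 0) (hd : DescAdmissible W d)
    (hχ : IsQuadraticCharacterOf χ d) : Nat.card (PrimeTwist.selmerGroup W χ) = selmerTwoCard W := by
  rw [primeTwist_selmerGroup_eq_selmerGroup_of_Δ_neg W hΔ hd hχ]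
  rfl

/-! ## §143 `Δ_W > 0` on the egg stratum -/

/-- **`Δ_W > 0`, `W` meets the egg: `Sel_𝔓(A_χ/ℚ) ≤ Sel₂(W)`** (there `Sel₂^{rel ∞}(W) = Sel₂(W)`, file 17), with `Sel₂^{str ∞}(W) ≤ Sel_𝔓(A_χ/ℚ)`
below it of index `≤ 2`. [cite: MazurRubin2010, Lemma 3.2] [cite: Kramer1981, Prop. 6] -/
theorem primeTwist_selmerGroup_le_selmerGroup_of_meetsEgg (hegg : MeetsEgg W) (hd : DescAdmissible W d) (hχ : IsQuadraticCharacterOf χ d) :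
    PrimeTwist.selmerGroup W χ ≤ W.selmerGroup ((2 : ℕ) : ℤ) := by
  rw [← selmerGroupRelaxedAtInfinityAtTwo_eq_selmerGroup_of_meetsEgg W hegg]
  exact primeTwist_selmerGroup_le_selmerGroupRelaxedAtInfinityAtTwo W hd hχ

omit [W.IsGloballyMinimal] in
/-- **The strict end in Selmer terms: `Sel₂^{str ∞}(W) = {c ∈ Sel₂(W) | loc_∞ c = 0}` whenever `Sel₂^{rel ∞}(W) = Sel₂(W)`** (e.g. on the egg
stratum, or for `Δ_W < 0`). [cite: MazurRubin2010, Def. 3.1] -/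
theorem mem_selmerGroup_kummerStrict_iff_of_relaxed_eq (hR : selmerGroupRelaxedAtInfinityAtTwo W = W.selmerGroup ((2 : ℕ) : ℤ))
    (w : InfinitePlace ℚ) (c : W.galH1Torsion ((2 : ℕ) : ℤ)) :
    c ∈ (kummerStrict W 2 {(Sum.inl w : Place ℚ)}).selmerGroup ↔
      c ∈ W.selmerGroup ((2 : ℕ) : ℤ) ∧ galoisCohomology.localization (W.torsionGaloisModule ((2 : ℕ) : ℤ)) (Sum.inl w) 1 c = 0 := by
  rw [← hR]
  exact mem_selmerGroup_kummerStrict_singleton_inl_iff W w c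

/-- **Summary on the egg stratum (`Δ_W > 0`, `MeetsEgg W`)**: `{c ∈ Sel₂(W) | loc_∞ c = 0} ≤ Sel_𝔓(A_χ/ℚ) ≤ Sel₂(W)` for every descent-admissible
`d`. [cite: MazurRubin2010, Lemma 3.2] -/
theorem primeTwist_selmerGroup_sandwich_of_meetsEgg (hegg : MeetsEgg W) (hd : DescAdmissible W d) (hχ : IsQuadraticCharacterOf χ d)
    (w : InfinitePlace ℚ) :
    W.selmerGroup ((2 : ℕ) : ℤ) ⊓ (galoisCohomology.localization (W.torsionGaloisModule ((2 : ℕ) : ℤ)) (Sum.inl w) 1).ker ≤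
        PrimeTwist.selmerGroup W χ ∧
      PrimeTwist.selmerGroup W χ ≤ W.selmerGroup ((2 : ℕ) : ℤ) := by
  refine ⟨fun c hc ↦ ?_, primeTwist_selmerGroup_le_selmerGroup_of_meetsEgg W hegg hd hχ⟩
  have hR := selmerGroupRelaxedAtInfinityAtTwo_eq_selmerGroup_of_meetsEgg W hegg
  have hc' : c ∈ (kummerStrict W 2 {(Sum.inl w : Place ℚ)}).selmerGroup :=
    (mem_selmerGroup_kummerStrict_iff_of_relaxed_eq W hR w c).mpr ⟨hc.1, AddMonoidHom.mem_ker.mp hc.2⟩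
  exact selmerGroup_kummerStrict_le_primeTwist_selmerGroup W hd hχ w hc'

end Summit.BirchSwinnertonDyer.BirchSwinnertonDyer.Theorems.GenusKolyArch

end
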